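/-
Copyright: harness tree, Literature layer (sorry-free). b2b-lace enum1-g53 (ENUMERATION SHARD A gen 53),
node KU-SEP-SEED-K1 (axis rows `|m| ≥ 2`): the FAR-SEED form of the truncation-error bound of a twisted seed
certificate. d-generic; number-free; what-if / input-certification lane device; no statement at any fixed
dimension.
-/
import Literature.Probability.FitznerVanDerHofstad2017.SrwTwistSeedCertRowBound
import HarnessLib

/-!
# Twisted SEEDCERT: the truncation error `truncErrT` with the error seeds placed at `(J+1)M e₀`

`TwCert.truncErrT c D n β M` (module `SrwTwistSeedCertRow`) is the row-truncation / coefficient-rounding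
error of the twisted axis seed `Tw_{n+1}(m e_i; β)`:
`Σ_{k<D} C(D,k+1) (2δ_J)^{k+1} I_{n+1,0}((J+1)M·(e_0+…+e_k)) + ((α'+η)^D − α'^D)/(2π)^D · I_{n+1,0}(0)`.
`TwCert.truncErrT_le` (module `SrwTwistSeedCertRowBound`) bounds it by three scalars with ONE seed bound
`I` for all `D + 1` seeds; its consumers so far take `M = 0` (`truncErrT_zero_le_cast`: every error seed at
the origin), which is sharp enough when the order tail `δ_J(β/D)` is tiny (rows `m = 1`, `m = 2` with the
full column truncation order `J`).

For the axis rows `|m| ≥ 2` the Bessel orders `j·m` of the certificate's row grow with `m`, and a SHORT row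
(small `J`) keeps them in the range of the kernel; then `δ_J` is NOT tiny and the error must be taken in its
genuine `M = m` form, where the error seeds sit at lattice distance `(J+1)M` from the origin and are small.
This file proves that form with TWO seed scalars:

* `TwCert.srwI_errSeed_le_axis` — every error seed is dominated by the AXIS one:
  `I_{n+1,0}((J+1)M·(e_0+…+e_k)) ≤ I_{n+1,0}((J+1)M·e_0)` (Lemma M `absMonotone_srwI`: `I_{n,l}` is
  non-increasing in each `|x_μ|`; `d ≥ 2(n+1)+1`);
* `TwCert.srwI_axisSeed_anti` — the axis seed is non-increasing in the distance:
  `I_{n+1,0}(R·e_0) ≤ I_{n+1,0}(R'·e_0)` for `R' ≤ R` (so a tabulated axis value at `R' ≤ (J+1)M` serves as `I_far`);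
* **`TwCert.truncErrT_le_far`** — if `δ_J(β/D) ≤ δ̄`, every literal weight is within `e` of `J_j(β/D)`,
  `I_{n+1,0}((J+1)M e_0) ≤ I_far` and `I_{n+1,0}(0) ≤ I₀`, then
  `truncErrT c D n β M ≤ ((1+2δ̄)^D − 1)·I_far + ((A + (2J+1)e)^D − A^D)·I₀`, `A = absMassQ c`;
* `TwCert.truncErrFarQ` — the same as a rational function of rational inputs, `cast_truncErrFarQ`, and
  **`TwCert.truncErrT_le_far_cast`** (`E ≤ ((truncErrFarQ c D δ̄ e I_far I₀ : ℚ) : ℝ)`), the shape a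
  kernel-decided consumer inequality uses (far seed literal from a decided far-node / I-table bound).

Everything is PROVED (standard axioms), generic in the dimension and number-free; one rational bookkeeping
definition (`truncErrFarQ`), no instance, no named fact. Epistemic status / lane: what-if /
input-certification SUPPORT; nothing here is a certificate; no statement at a specific dimension.

## References
* R. Fitzner, R. van der Hofstad, *Generalized approach to the non-backtracking lace expansion*,
  PTRF 169 (2017) 1041–1119 (arXiv:1506.07969), (3.34)–(3.36) p. 1071, §5.1.1 (5.2)–(5.5) pp. 1089–1090
  (the Bessel-row evaluation of the SRW integrals of the notebook `SRW.nb` §1). [FitznerVanDerHofstad2016NoBLE]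
* T. Hara, G. Slade, *The lace expansion for self-avoiding walk in five or more dimensions*, Rev. Math.
  Phys. 4 (1992) 235–327, App. B Lemma B.3 (monotonicity of `I_{n,0}` in `|x_μ|`). [HaraSlade1992b]
[cite: FitznerVanDerHofstad2016NoBLE, §5.1.1 (5.2)–(5.5) pp. 1089–1090]
-/

set_option Elab.async false

namespace Literature.Probability.FitznerVanDerHofstad2017.SeedCert

open Real MeasureTheory Set Finset
open Literature.Probability.LatticeModels (besselI)
open Literature.Analysis.FunctionSpaces (besselJ)
open scoped Nat

namespace TwCert

variable (c : TwCert) (D : ℕ)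

/-- **Every error seed is dominated by the axis one**: for `d = D ≥ 2(n+1)+1`, every `R` and every `k`,
`I_{n+1,0}(R·(e_0+…+e_k)) ≤ I_{n+1,0}(R·e_0)` (Lemma M, `absMonotone_srwI`).
[cite: HaraSlade1992b, App. B Lemma B.3] -/
theorem srwI_errSeed_le_axis (n : ℕ) (hD : 2 * (n + 1) + 1 ≤ D) (R : ℕ) (k : ℕ) :
    srwI D (n + 1) 0 (fun μ : Fin D => if (μ : ℕ) < k + 1 then ((R : ℕ) : ℤ) else 0)
      ≤ srwI D (n + 1) 0 (fun μ : Fin D => if (μ : ℕ) < 1 then ((R : ℕ) : ℤ) else 0) := by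
  refine absMonotone_srwI (d := D) (n := n + 1) (by omega) (by omega) 0 _ _ fun μ => ?_
  by_cases h1 : (μ : ℕ) < 1
  · have hk : (μ : ℕ) < k + 1 := by omega
    simp [h1, hk]
  · simp [h1]

/-- **The axis seed is non-increasing in the distance**: for `d = D ≥ 2(n+1)+1` and `R' ≤ R`,
`I_{n+1,0}(R·e_0) ≤ I_{n+1,0}(R'·e_0)` (Lemma M, `absMonotone_srwI`) — so a far error seed at `(J+1)M ≥ R'` is
bounded by any tabulated axis value at `R'·e_0`. [cite: HaraSlade1992b, App. B Lemma B.3] -/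
theorem srwI_axisSeed_anti (n : ℕ) (hD : 2 * (n + 1) + 1 ≤ D) {R R' : ℕ} (hR : R' ≤ R) :
    srwI D (n + 1) 0 (fun μ : Fin D => if (μ : ℕ) < 1 then ((R : ℕ) : ℤ) else 0)
      ≤ srwI D (n + 1) 0 (fun μ : Fin D => if (μ : ℕ) < 1 then ((R' : ℕ) : ℤ) else 0) := by
  refine absMonotone_srwI (d := D) (n := n + 1) (by omega) (by omega) 0 _ _ fun μ => ?_
  by_cases h1 : (μ : ℕ) < 1
  · have h : ((R' : ℕ) : ℤ) ≤ ((R : ℕ) : ℤ) := by exact_mod_cast hR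
    simp only [h1, if_true, Nat.abs_cast]
    exact h
  · simp [h1]

/-- **`truncErrT` from four scalars, far-seed form.** For `2(n+1)+1 ≤ D`, `0 < qden`: if the Bessel-`J` order
tail is `≤ δ̄`, every literal weight is within `e` of `J_j(β/D)` (`j ≤ J`), the AXIS error seed satisfies
`I_{n+1,0}((J+1)M·e_0) ≤ I_far` and `I_{n+1,0}(0) ≤ I₀`, then
`truncErrT c D n β M ≤ ((1+2δ̄)^D − 1)·I_far + ((A + (2J+1)e)^D − A^D)·I₀`, `A = absMassQ c`.
[cite: FitznerVanDerHofstad2016NoBLE, §5.1.1 (5.2)–(5.5) pp. 1089–1090] -/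
theorem truncErrT_le_far (n : ℕ) (hD : 2 * (n + 1) + 1 ≤ D) (hq : 0 < c.qden) (β : ℝ) (M : ℕ)
    {δb e Ifar I0 : ℝ}
    (hδ : ∑' l : ℕ, |besselJ (l + c.J + 1) (β / D)| ≤ δb)
    (he : ∀ j ∈ Finset.range (c.J + 1), |((c.Q j : ℤ) : ℝ) / (c.qden : ℝ) - besselJ j (β / D)| ≤ e)
    (hIfar : srwI D (n + 1) 0 (fun μ : Fin D => if (μ : ℕ) < 1 then ((((c.J + 1) * M : ℕ)) : ℤ) else 0) ≤ Ifar)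
    (hI0 : srwI D (n + 1) 0 (fun _ : Fin D => 0) ≤ I0) :
    c.truncErrT D n β M
      ≤ ((1 + 2 * δb) ^ D - 1) * Ifar
          + ((((c.absMassQ : ℚ) : ℝ) + (2 * c.J + 1) * e) ^ D - ((c.absMassQ : ℚ) : ℝ) ^ D) * I0 := by
  -- names
  set δ : ℝ := ∑' l : ℕ, |besselJ (l + c.J + 1) (β / D)| with hδdef
  set I₀ : ℝ := srwI D (n + 1) 0 (fun _ : Fin D => 0) with hI₀def
  set A : ℝ := ((c.absMassQ : ℚ) : ℝ) with hAdef
  set η : ℝ := ∑ j ∈ Finset.range (c.J + 1), (if j = 0 then (1 : ℝ) else 2)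
      * ‖2 * π * Complex.I ^ j * (besselJ j (β / D) : ℂ) - c.cT j‖ with hηdef
  have hδ0 : 0 ≤ δ := tsum_nonneg fun _ => abs_nonneg _
  have hδb0 : 0 ≤ δb := hδ0.trans hδ
  have hI₀0 : 0 ≤ I₀ := srwI_nonneg (d := D) (n + 1) hD 0 _
  have hI00 : 0 ≤ I0 := hI₀0.trans hI0
  have hIfar0 : 0 ≤ Ifar := (srwI_nonneg (d := D) (n + 1) hD 0 _).trans hIfar
  have hA0 : 0 ≤ A := by rw [hAdef]; exact_mod_cast c.absMassQ_nonneg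
  have he0 : 0 ≤ e := (abs_nonneg _).trans (he 0 (by simp))
  have hw : ∀ j : ℕ, (0 : ℝ) ≤ (if j = 0 then (1 : ℝ) else 2) := fun j => by split_ifs <;> norm_num
  have hη0 : 0 ≤ η := Finset.sum_nonneg fun j _ => mul_nonneg (hw j) (norm_nonneg _)
  have h2π : (0 : ℝ) < 2 * π := by positivity
  -- every error seed is below the axis one, hence below `Ifar`
  have hIk : ∀ k ∈ Finset.range D, srwI D (n + 1) 0
      (fun μ : Fin D => if (μ : ℕ) < k + 1 then ((((c.J + 1) * M : ℕ)) : ℤ) else 0) ≤ Ifar :=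
    fun k _ => (srwI_errSeed_le_axis D n hD ((c.J + 1) * M) k).trans hIfar
  -- the first term
  have hT1 : (∑ k ∈ Finset.range D, (D.choose (k + 1) : ℝ) * (2 * δ) ^ (k + 1)
      * srwI D (n + 1) 0
          (fun μ : Fin D => if (μ : ℕ) < k + 1 then ((((c.J + 1) * M : ℕ)) : ℤ) else 0))
      ≤ ((1 + 2 * δb) ^ D - 1) * Ifar := by
    calc (∑ k ∈ Finset.range D, (D.choose (k + 1) : ℝ) * (2 * δ) ^ (k + 1)
          * srwI D (n + 1) 0
            (fun μ : Fin D => if (μ : ℕ) < k + 1 then ((((c.J + 1) * M : ℕ)) : ℤ) else 0))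
        ≤ ∑ k ∈ Finset.range D, (D.choose (k + 1) : ℝ) * (2 * δb) ^ (k + 1) * Ifar := by
          refine Finset.sum_le_sum fun k hk => ?_
          have h1 : (2 * δ) ^ (k + 1) ≤ (2 * δb) ^ (k + 1) :=
            pow_le_pow_left₀ (by positivity) (by linarith) _
          have h0 : 0 ≤ srwI D (n + 1) 0
              (fun μ : Fin D => if (μ : ℕ) < k + 1 then ((((c.J + 1) * M : ℕ)) : ℤ) else 0) :=
            srwI_nonneg (d := D) (n + 1) hD 0 _
          exact mul_le_mul (mul_le_mul_of_nonneg_left h1 (Nat.cast_nonneg _)) (hIk k hk) h0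
            (by positivity)
      _ = ((1 + 2 * δb) ^ D - 1) * Ifar := by
          rw [← Finset.sum_mul, sum_choose_succ_mul_pow_succ]
  -- the second term
  have hα : ∑ j ∈ Finset.range (c.J + 1), (if j = 0 then (1 : ℝ) else 2) * ‖c.cT j‖ = 2 * π * A :=
    c.sum_weight_norm_cT hq
  have hη : η ≤ (2 * c.J + 1) * (2 * π * e) := by
    calc η ≤ ∑ j ∈ Finset.range (c.J + 1), (if j = 0 then (1 : ℝ) else 2) * (2 * π * e) := by
          refine Finset.sum_le_sum fun j hj => mul_le_mul_of_nonneg_left ?_ (hw j)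
          have h := Literature.Analysis.FunctionSpaces.JLit.norm_coeff_sub_coeff_le j (he j hj)
          simpa only [TwCert.cT] using h
      _ = (2 * c.J + 1) * (2 * π * e) := by rw [← Finset.sum_mul, sum_rowWeight_eq]
  have hT2 : ((∑ j ∈ Finset.range (c.J + 1), (if j = 0 then (1 : ℝ) else 2) * ‖c.cT j‖ + η) ^ D
        - (∑ j ∈ Finset.range (c.J + 1), (if j = 0 then (1 : ℝ) else 2) * ‖c.cT j‖) ^ D) / (2 * π) ^ D
        * I₀ ≤ ((A + (2 * c.J + 1) * e) ^ D - A ^ D) * I0 := by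
    rw [hα]
    have h1 : (2 * π * A + η) ^ D ≤ (2 * π * A + (2 * c.J + 1) * (2 * π * e)) ^ D :=
      pow_le_pow_left₀ (by positivity) (by linarith) D
    have h2 : (2 * π * A + (2 * c.J + 1) * (2 * π * e)) ^ D = (2 * π) ^ D * (A + (2 * c.J + 1) * e) ^ D := by
      rw [← mul_pow]; ring
    have h3 : (2 * π * A) ^ D = (2 * π) ^ D * A ^ D := mul_pow _ _ _
    have hnum : (2 * π * A + η) ^ D - (2 * π * A) ^ D ≤ ((A + (2 * c.J + 1) * e) ^ D - A ^ D) * (2 * π) ^ D := by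
      rw [sub_mul, mul_comm ((A + (2 * c.J + 1) * e) ^ D), mul_comm (A ^ D), ← h2, ← h3]
      linarith
    have hfrac : ((2 * π * A + η) ^ D - (2 * π * A) ^ D) / (2 * π) ^ D ≤ (A + (2 * c.J + 1) * e) ^ D - A ^ D :=
      (div_le_iff₀ (pow_pos h2π D)).2 hnum
    have hfrac0 : 0 ≤ ((2 * π * A + η) ^ D - (2 * π * A) ^ D) / (2 * π) ^ D :=
      div_nonneg (sub_nonneg.2 (pow_le_pow_left₀ (by positivity) (by linarith) D)) (pow_nonneg h2π.le D)
    exact mul_le_mul hfrac hI0 hI₀0 (hfrac0.trans hfrac)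
  -- assemble
  have key := add_le_add hT1 hT2
  calc c.truncErrT D n β M
      = (∑ k ∈ Finset.range D, (D.choose (k + 1) : ℝ) * (2 * δ) ^ (k + 1)
          * srwI D (n + 1) 0
            (fun μ : Fin D => if (μ : ℕ) < k + 1 then ((((c.J + 1) * M : ℕ)) : ℤ) else 0))
        + ((∑ j ∈ Finset.range (c.J + 1), (if j = 0 then (1 : ℝ) else 2) * ‖c.cT j‖ + η) ^ D
            - (∑ j ∈ Finset.range (c.J + 1), (if j = 0 then (1 : ℝ) else 2) * ‖c.cT j‖) ^ D) / (2 * π) ^ D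
          * I₀ := by
        rw [truncErrT]
    _ ≤ ((1 + 2 * δb) ^ D - 1) * Ifar + ((A + (2 * c.J + 1) * e) ^ D - A ^ D) * I0 := key

/-- The four-scalar far-seed bound as a RATIONAL function of rational inputs:
`truncErrFarQ c D δ̄ e I_far I₀ = ((1+2δ̄)^D − 1)·I_far + ((A + (2J+1)e)^D − A^D)·I₀`, `A = absMassQ c`.
[cite: FitznerVanDerHofstad2016NoBLE, §5.1.1 (5.2)–(5.5) pp. 1089–1090] -/
def truncErrFarQ (δb e Ifar I0 : ℚ) : ℚ :=
  ((1 + 2 * δb) ^ D - 1) * Ifar + ((c.absMassQ + (2 * c.J + 1) * e) ^ D - c.absMassQ ^ D) * I0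

/-- Cast of `truncErrFarQ`. [cite: FitznerVanDerHofstad2016NoBLE, §5.1.1 (5.2)–(5.5) pp. 1089–1090] -/
theorem cast_truncErrFarQ (δb e Ifar I0 : ℚ) :
    ((c.truncErrFarQ D δb e Ifar I0 : ℚ) : ℝ)
      = ((1 + 2 * (δb : ℝ)) ^ D - 1) * (Ifar : ℝ)
          + ((((c.absMassQ : ℚ) : ℝ) + (2 * c.J + 1) * (e : ℝ)) ^ D - ((c.absMassQ : ℚ) : ℝ) ^ D) * (I0 : ℝ) := by
  rw [truncErrFarQ]; push_cast; ring

/-- **Far-seed form, rational inputs:** `truncErrT c D n β M ≤ ((truncErrFarQ c D δ̄ e I_far I₀ : ℚ) : ℝ)` — the shape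
consumed by a kernel-decided literal inequality (axis rows `|m| ≥ 2` with a short certificate row).
[cite: FitznerVanDerHofstad2016NoBLE, §5.1.1 (5.2)–(5.5) pp. 1089–1090] -/
theorem truncErrT_le_far_cast (n : ℕ) (hD : 2 * (n + 1) + 1 ≤ D) (hq : 0 < c.qden) (β : ℝ) (M : ℕ)
    {δb e Ifar I0 : ℚ}
    (hδ : ∑' l : ℕ, |besselJ (l + c.J + 1) (β / D)| ≤ (δb : ℝ))
    (he : ∀ j ∈ Finset.range (c.J + 1), |((c.Q j : ℤ) : ℝ) / (c.qden : ℝ) - besselJ j (β / D)| ≤ (e : ℝ))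
    (hIfar : srwI D (n + 1) 0 (fun μ : Fin D => if (μ : ℕ) < 1 then ((((c.J + 1) * M : ℕ)) : ℤ) else 0) ≤ (Ifar : ℝ))
    (hI0 : srwI D (n + 1) 0 (fun _ : Fin D => 0) ≤ (I0 : ℝ)) :
    c.truncErrT D n β M ≤ ((c.truncErrFarQ D δb e Ifar I0 : ℚ) : ℝ) := by
  rw [cast_truncErrFarQ]
  exact c.truncErrT_le_far D n hD hq β M hδ he hIfar hI0

/-- The far-seed bound dominates the one-scalar bound of `truncErrT_le` only through its inputs: with
`I_far = I₀ = I` it IS that bound (`truncErrFarQ δ̄ e I I = truncErrQ δ̄ e I`).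
[cite: FitznerVanDerHofstad2016NoBLE, §5.1.1 (5.2)–(5.5) pp. 1089–1090] -/
theorem truncErrFarQ_self (δb e I : ℚ) : c.truncErrFarQ D δb e I I = c.truncErrQ D δb e I := by
  rw [truncErrFarQ, truncErrQ]; ring

end TwCert

end Literature.Probability.FitznerVanDerHofstad2017.SeedCert
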